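import Literature.Geometry.Kaehler.ComplexTorusNeronSeveriLatticeLefschetzSignature
import Literature.Geometry.Kaehler.ComplexTorusLefschetzFormPrimitiveLatticeSignature
import Literature.Geometry.Kaehler.ComplexTorusTranscendentalLatticeDiscriminant
import Literature.Topology.FourManifolds.LatticeFormsOrthogonalComplementDiscriminantDivisibility
import Literature.Topology.FourManifolds.LatticeFormsPrimitiveSublatticeDiscriminant
import HarnessLib

/-!
# The transcendental lattice of a polarised abelian variety: `T = NS(X)^⊥ ⊂ H²(X, ℤ)` for the Lefschetz form
# `B₂` has signature `(2h^{2,0}, h^{1,1} − ρ) = (g² − g, g² − ρ)` up to the Kähler sign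

Layer `Literature/Geometry/Kaehler`, namespace `Literature.Geometry.Kaehler.ComplexTorus`; lane `lit-hodgefound`
(Track 2 foundations library), seat p09, generation 44, row g44-#5. THEOREMS ONLY (0 definitions); no named fact,
net debt 0. Completes the p09 lattice series: g43-#3 (`H²(X, ℤ)`: `(2h^{2,0} + 1, h^{1,1} − 1)`), g43-#4 (`P²(X, ℤ)`:
`(2h^{2,0}, h^{1,1} − 1)`), g43-#5 (`NS(X)`: `(1, ρ − 1)`), g44-#1 (`θ^⊥ ∩ NS`: `(0, ρ − 1)`) by the orthogonal
complement of the Néron–Severi lattice inside `H²(X, ℤ)`: **`(NS(X)^⊥, s·B₂)` has `(b⁺, b⁻) = (2h^{2,0}, h^{1,1} − ρ)`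
and rank `b₂ − ρ`** — Shioda–Mitani's / Huybrechts' transcendental lattice `T_X` of signature `(2, 4 − ρ)` (surfaces,
p18's `ComplexTorusTranscendentalLatticeSignature`) in every dimension `g ≥ 2`, with the degree-two Lefschetz form
`B₂(x, y) = ⟨x, γ_{g−2} ∧ y⟩` in place of the cup product.

## Dictionary

`X = E/Φ(ℤ^ι)` of dimension `g = j + 2`, type `d`, orientation `e`, `sign = orientationSign Φ e`, `s = sign·(−1)^j`;
`γ = γ_{g−2}` (`j!·d₁⋯d_j·γ = θ^{∧j}`), `B(x, y) = ⟨x, γ ∧ y⟩_e` on `H²(X, ℤ) = integralForms Φ 2` (hypothesis `hB`);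
`S = S_X = H²(X, ℤ) ∩ H^{1,1} = AddSubgroup.toIntSubmodule ((integralHodgeClasses Φ 1).addSubgroupOf (integralForms Φ 2))`
the Néron–Severi SUBLATTICE of `H²(X, ℤ)` (p18's vocabulary; `≅ NS(X)` by the integral Lefschetz `(1,1)` theorem
`neronSeveriGroupEquiv`), `ρ = rk NS(X) = finrank ℤ (neronSeveriGroup Φ)`; `T = B.orthogonal S` its orthogonal
complement for `B₂` — the TRANSCENDENTAL LATTICE of `(X, θ)` in degree two; `h^{2,0} = C(g,2)`, `h^{1,1} = g²`,
`b₂ = C(2g, 2)`.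

## What is proved

* §0 lattice algebra (any symmetric `B` on a finitely generated `ℤ`-module `M`, any sublattice `L` with a basis of
  Gram determinant `≠ 0`): `sigPos_sigNeg_eq_add_restrict_orthogonal_of_det_ne_zero`
  (**`b^±(B) = b^±(B|L) + b^±(B|L^⊥)`** — `L ⊕ L^⊥` is an orthogonal sum of finite index, Kitaoka 5.3.3, and the
  indices are index-invariant, Serre V §1.3.2), `inf_orthogonal_eq_bot_of_det_ne_zero` (`L ∩ L^⊥ = 0`),
  `nondegenerate_restrict_orthogonal_of_det_ne_zero` (`B` non-degenerate ⟹ `B|L^⊥` non-degenerate).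
* §1 `IsPolarizationType.sigPos_sigNeg_smul_restrict_integralHodgeClasses_of_eq_poincarePairing_wedge`:
  `(S_X, s·B₂) = (1, ρ − 1)`, `rk S_X = ρ`, Gram determinant `≠ 0` (g43-#5 transported along `NS(X) ≅ S_X`);
  the headline `IsPolarizationType.sigPos_sigNeg_smul_restrict_transcendental_of_eq_poincarePairing_wedge`:
  **`(T, s·B₂) = (2·C(g,2), g² − ρ) = (2h^{2,0}, h^{1,1} − ρ)`**; `…finrank_transcendental…` (`rk T = C(2g,2) − ρ`,
  `S ∩ T = 0`, `B₂|T` non-degenerate); the Riemann-form / principal / threefold readings (pp threefold: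
  `(T, −sign·B₂) = (6, 9 − ρ)`, `rk T = 15 − ρ`).

## The sources, verbatim

* T. Shioda, N. Mitani (1974), §1: "`T_X` denote the orthogonal complement of `S̄_X` in `H_X` … `S̄_X` has the
  signature `(1, ρ − 1)` … `T_X` … `(2, 4 − ρ)`" (surfaces).
* D. Huybrechts, *Lectures on K3 Surfaces* (2016), Ch. 3 §3.3 / Ch. 14 §0.2: `T(X) = NS(X)^⊥` of signature
  `(2, 20 − ρ)` (K3), "`Λ₁ ⊕ Λ₁^⊥ ⊂ Λ` is of finite index"; Ch. 14 §0.1.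
* Y. Kitaoka, *Arithmetic of Quadratic Forms* (1993), Ch. 5 Prop. 5.3.3 (proof): `[N : L ⊥ L^⊥]` is finite and divides
  `[L^♯ : L]` (the tree's `index_sup_orthogonal_ne_zero`).
* J.-P. Serre, *A Course in Arithmetic*, Ch. V §1.3.2 (signature read on `E ⊗ ℝ`, finite-index invariance), §1.3.7.
* D. Huybrechts, *Complex Geometry*, Cor. 3.3.16 (`(2h^{2,0} + 1, h^{1,1} − 1)` on `H²`); H. Lange (2023), §6.2.4, §5.1.2.

## References

* [ShiodaMitani1974] T. Shioda, N. Mitani, Singular abelian surfaces and binary quadratic forms, LNM 412 (1974), §1.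
* [Huybrechts2016K3] D. Huybrechts, Lectures on K3 Surfaces, CUP 2016, Ch. 3 §3.3; Ch. 14 §0.1–§0.2.
* [Kitaoka1993] Y. Kitaoka, Arithmetic of Quadratic Forms, CUP 1993, Ch. 5 Prop. 5.3.3.
* [Serre1973] J.-P. Serre, A Course in Arithmetic, GTM 7, Springer 1973, Ch. V §1.3.2, §1.3.7.
* [Huybrechts2005] D. Huybrechts, Complex Geometry. An Introduction, Springer 2005, Cor. 3.3.16.
* [Lange2023AbelianVarietiesComplex] H. Lange, Abelian Varieties over the Complex Numbers, Springer 2023, §1.2.2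
  Prop. 1.2.9, §1.3.1, §5.1.2, §6.2.4.
* [MilnorHusemoller1973] J. Milnor, D. Husemoller, Symmetric Bilinear Forms, Springer 1973, Ch. I §3.
-/

noncomputable section

open Module Function
open LinearMap (BilinForm)
open Literature.LinearAlgebra.Alternating

namespace Literature.Geometry.Kaehler.ComplexTorus

/-! ## §0 Lattice algebra: `b^±(B) = b^±(B|L) + b^±(B|L^⊥)` for a sublattice of non-zero Gram determinant -/

section LatticeComplement

variable {M : Type*} [AddCommGroup M]

/-- **`b⁺(B) = b⁺(B|L) + b⁺(B|L^⊥)` and `b⁻(B) = b⁻(B|L) + b⁻(B|L^⊥)`** for a symmetric lattice form `B` on a finitely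
generated `ℤ`-module and a sublattice `L` whose Gram determinant (on some `ℤ`-basis) is non-zero — no unimodularity, no
primitivity: the orthogonal sum `L ⊕ L^⊥ → M` is an isometry onto a sublattice of FINITE index (Kitaoka: `[M : L ⊥ L^⊥]`
divides `|det G_L|`), a finite-index sublattice has the same indices (Serre: the signature is read on `E ⊗ ℝ`), and the
indices add on orthogonal sums. The rank-one case `L = ℤu` is g43-#4's
`sigPos_sigNeg_restrict_orthogonal_span_singleton_of_apply_self_pos`. [cite: Kitaoka1993, Ch. 5 Prop. 5.3.3 (proof)] [cite: Serre1973, Ch. V §1.3.2 and §1.3.7] [cite: Huybrechts2016K3, Ch. 14 §0.1 ("of finite index")] -/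
theorem sigPos_sigNeg_eq_add_restrict_orthogonal_of_det_ne_zero [Module.Finite ℤ M] (B : BilinForm ℤ M)
    (hB : B.IsSymm) (L : Submodule ℤ M) {κ : Type*} [Fintype κ] [DecidableEq κ] (bL : Basis κ ℤ L)
    (hdet : (LinearMap.BilinForm.toMatrix bL (B.restrict L)).det ≠ 0) :
    sigPos B.toQuadraticMap =
        sigPos (B.restrict L).toQuadraticMap + sigPos (B.restrict (B.orthogonal L)).toQuadraticMap ∧
      sigNeg B.toQuadraticMap =
        sigNeg (B.restrict L).toQuadraticMap + sigNeg (B.restrict (B.orthogonal L)).toQuadraticMap := by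
  classical
  -- the orthogonal sum `L ⊕ L^⊥ → M` is an isometry …
  have hφ : ∀ x y : ↥L × ↥(B.orthogonal L),
      B ((L.subtype.coprod (B.orthogonal L).subtype) x) ((L.subtype.coprod (B.orthogonal L).subtype) y) =
        ((B.restrict L).prod (B.restrict (B.orthogonal L))) x y := by
    intro x y
    have h1 : B (x.1 : M) (y.2 : M) = 0 := (LinearMap.BilinForm.mem_orthogonal_iff.1 y.2.2) _ x.1.2
    have h2 : B (x.2 : M) (y.1 : M) = 0 := by
      rw [hB.eq]; exact (LinearMap.BilinForm.mem_orthogonal_iff.1 x.2.2) _ y.1.2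
    simp only [LinearMap.coprod_apply, Submodule.subtype_apply, map_add, LinearMap.add_apply, h1, h2, add_zero, zero_add,
      LinearMap.BilinForm.prod_apply]
    rfl
  -- … onto a sublattice of finite index
  have hfi : ∀ v : M, ∃ n : ℤ, n ≠ 0 ∧ n • v ∈ LinearMap.range (L.subtype.coprod (B.orthogonal L).subtype) := by
    intro v
    refine ⟨((L ⊔ B.orthogonal L).toAddSubgroup.index : ℤ),
      Int.natCast_ne_zero.2 (Literature.Topology.FourManifolds.index_sup_orthogonal_ne_zero B L hB bL hdet), ?_⟩
    rw [LinearMap.range_coprod, Submodule.range_subtype, Submodule.range_subtype, Nat.cast_smul_eq_nsmul]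
    exact (L ⊔ B.orthogonal L).toAddSubgroup.nsmul_index_mem v
  have hP := LinearMap.BilinForm.sigPos_eq_of_comp_of_finiteIndex
    ((B.restrict L).prod (B.restrict (B.orthogonal L))) B _ hφ hfi
  have hN := LinearMap.BilinForm.sigNeg_eq_of_comp_of_finiteIndex
    ((B.restrict L).prod (B.restrict (B.orthogonal L))) B _ hφ hfi
  rw [LinearMap.BilinForm.sigPos_prod _ _ (hB.restrict _) (hB.restrict _)] at hP
  rw [LinearMap.BilinForm.sigNeg_prod _ _ (hB.restrict _) (hB.restrict _)] at hN
  exact ⟨hP.symm, hN.symm⟩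

/-- **`L ∩ L^⊥ = 0`** when the Gram determinant of `L` is non-zero (`B|L` is then non-degenerate).
[cite: Huybrechts2016K3, Ch. 14 §0.1] [cite: MilnorHusemoller1973, Ch. I §3] -/
theorem inf_orthogonal_eq_bot_of_det_ne_zero (B : BilinForm ℤ M) (L : Submodule ℤ M) {κ : Type*} [Fintype κ]
    [DecidableEq κ] (bL : Basis κ ℤ L) (hdet : (LinearMap.BilinForm.toMatrix bL (B.restrict L)).det ≠ 0) :
    L ⊓ B.orthogonal L = ⊥ := by
  have hnd := LinearMap.BilinForm.nondegenerate_of_det_ne_zero _ bL hdet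
  rw [Submodule.eq_bot_iff]
  rintro x ⟨hxL, hxO⟩
  have h : (⟨x, hxL⟩ : L) = 0 := hnd.2 ⟨x, hxL⟩ fun y ↦ by
    rw [LinearMap.BilinForm.restrict_apply]
    exact (LinearMap.BilinForm.mem_orthogonal_iff.1 hxO) _ y.2
  exact congrArg Subtype.val h

/-- **`B|L^⊥` is non-degenerate** when `B` is non-degenerate and symmetric and the Gram determinant of `L` is non-zero:
if `t ∈ L^⊥` pairs to zero with `L^⊥`, it pairs to zero with the finite-index sublattice `L ⊕ L^⊥`, hence with
everything. [cite: Huybrechts2016K3, Ch. 14 §0.1–§0.2] [cite: Kitaoka1993, Ch. 5 Prop. 5.3.3 (proof)] -/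
theorem nondegenerate_restrict_orthogonal_of_det_ne_zero (B : BilinForm ℤ M) (hB : B.IsSymm) (hBn : B.Nondegenerate)
    (L : Submodule ℤ M) {κ : Type*} [Fintype κ] [DecidableEq κ] (bL : Basis κ ℤ L)
    (hdet : (LinearMap.BilinForm.toMatrix bL (B.restrict L)).det ≠ 0) :
    (B.restrict (B.orthogonal L)).Nondegenerate := by
  have hidx := Literature.Topology.FourManifolds.index_sup_orthogonal_ne_zero B L hB bL hdet
  -- separating on the left suffices (the restriction is symmetric, hence reflexive)
  refine (LinearMap.IsRefl.nondegenerate_iff_separatingLeft (LinearMap.BilinForm.IsSymm.isRefl (hB.restrict _))).2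
    fun t ht ↦ ?_
  have hzero : ∀ v : M, B (t : M) v = 0 := fun v ↦ by
    -- `n • v ∈ L ⊔ L^⊥` with `n = [M : L ⊕ L^⊥] ≠ 0`
    have hmem : ((L ⊔ B.orthogonal L).toAddSubgroup.index : ℤ) • v ∈ L ⊔ B.orthogonal L := by
      rw [Nat.cast_smul_eq_nsmul]
      exact (L ⊔ B.orthogonal L).toAddSubgroup.nsmul_index_mem v
    obtain ⟨l, hl, w, hw, hlw⟩ := Submodule.mem_sup.1 hmem
    have h1 : B (t : M) l = 0 := by rw [hB.eq]; exact (LinearMap.BilinForm.mem_orthogonal_iff.1 t.2) _ hl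
    have h2 : B (t : M) w = 0 := by
      have h := ht ⟨w, hw⟩
      rwa [LinearMap.BilinForm.restrict_apply] at h
    have h3 : B (t : M) (((L ⊔ B.orthogonal L).toAddSubgroup.index : ℤ) • v) = 0 := by
      rw [← hlw, map_add, h1, h2, add_zero]
    rw [LinearMap.BilinForm.smul_right] at h3
    exact (mul_eq_zero.1 h3).resolve_left (Int.natCast_ne_zero.2 hidx)
  exact Subtype.ext (hBn.1 (t : M) hzero)

/-- Isometric lattice forms have the same indices of inertia. [cite: Serre1973, Ch. V §1.3.2] -/
private theorem sigPos_sigNeg_eq_of_equivalent₆₆ {M' : Type*} [AddCommGroup M'] [Module ℤ M'] {N : Type*}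
    [AddCommGroup N] [Module ℤ N] {Q : BilinForm ℤ N} {Q' : BilinForm ℤ M'} (h : Q.Equivalent Q') :
    sigPos Q.toQuadraticMap = sigPos Q'.toQuadraticMap ∧ sigNeg Q.toQuadraticMap = sigNeg Q'.toQuadraticMap := by
  obtain ⟨f⟩ := h
  have hq : Q.toQuadraticMap.Equivalent Q'.toQuadraticMap :=
    ⟨{ f.toLinearEquiv with map_app' := fun x ↦ by simp }⟩
  exact ⟨hq.sigPos_eq, hq.sigNeg_eq⟩

end LatticeComplement

/-! ## §1 `NS(X) ⊂ H²(X, ℤ)` and its orthogonal complement for the Lefschetz form `B₂` -/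

section Transcendental

variable {ι : Type*} [Fintype ι] [DecidableEq ι] {E : Type*} [NormedAddCommGroup E] [NormedSpace ℂ E]
  {Φ : (ι → ℝ) ≃L[ℝ] E} {j n : ℕ} {η : E [⋀^Fin 2]→L[ℝ] ℝ} {d : Fin (j + 2) → ℕ}

omit [DecidableEq ι] in
variable (Φ) in
/-- **`NS(X) ≅ S_X = H²(X, ℤ) ∩ H^{1,1}` as `ℤ`-modules, `D ↦ D_ℂ`** (the integral Lefschetz `(1,1)` theorem
`neronSeveriGroupEquiv`, with `S_X` viewed inside the lattice `H²(X, ℤ)`). [cite: Lange2023AbelianVarietiesComplex, §1.2.2 Prop. 1.2.9; §1.3.1] [cite: ShiodaMitani1974, §1 (definition of `S_X`)] -/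
theorem exists_linearEquiv_neronSeveriGroup_integralHodgeClasses :
    ∃ eNS : neronSeveriGroup Φ ≃ₗ[ℤ]
        ↥(AddSubgroup.toIntSubmodule ((integralHodgeClasses Φ 1).addSubgroupOf (integralForms Φ 2))),
      ∀ D : neronSeveriGroup Φ, (((eNS D : ↥(AddSubgroup.toIntSubmodule
        ((integralHodgeClasses Φ 1).addSubgroupOf (integralForms Φ 2)))) : ↥(integralForms Φ 2)) : E [⋀^Fin 2]→L[ℝ] ℂ) =
        ofRealForm (D : E [⋀^Fin 2]→L[ℝ] ℝ) := by
  let f : neronSeveriGroup Φ →ₗ[ℤ]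
      ↥(AddSubgroup.toIntSubmodule ((integralHodgeClasses Φ 1).addSubgroupOf (integralForms Φ 2))) :=
    (AddMonoidHom.mk' (fun D : neronSeveriGroup Φ ↦
        (⟨⟨ofRealForm (D : E [⋀^Fin 2]→L[ℝ] ℝ), ofRealForm_mem_integralForms_two Φ ((mem_neronSeveriGroup_iff Φ).1 D.2)⟩,
          (mem_toIntSubmodule_addSubgroupOf_integralHodgeClasses_iff Φ).2
            (ofRealForm_mem_integralHodgeClasses_one Φ D.2)⟩ :
          ↥(AddSubgroup.toIntSubmodule ((integralHodgeClasses Φ 1).addSubgroupOf (integralForms Φ 2)))))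
      (fun D D' ↦ Subtype.ext (Subtype.ext (by
        change ofRealForm ((D : E [⋀^Fin 2]→L[ℝ] ℝ) + (D' : E [⋀^Fin 2]→L[ℝ] ℝ)) =
          ofRealForm (D : E [⋀^Fin 2]→L[ℝ] ℝ) + ofRealForm (D' : E [⋀^Fin 2]→L[ℝ] ℝ)
        exact ofRealForm_add _ _)))).toIntLinearMap
  have hf : ∀ D : neronSeveriGroup Φ, (((f D : ↥(AddSubgroup.toIntSubmodule
      ((integralHodgeClasses Φ 1).addSubgroupOf (integralForms Φ 2)))) : ↥(integralForms Φ 2)) : E [⋀^Fin 2]→L[ℝ] ℂ) =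
      ofRealForm (D : E [⋀^Fin 2]→L[ℝ] ℝ) := fun D ↦ rfl
  have hinj : Injective f := fun D D' h ↦ by
    have h' := congrArg (fun y : ↥(AddSubgroup.toIntSubmodule
      ((integralHodgeClasses Φ 1).addSubgroupOf (integralForms Φ 2))) ↦ ((y : ↥(integralForms Φ 2)) : E [⋀^Fin 2]→L[ℝ] ℂ)) h
    simp only [hf] at h'
    exact Subtype.ext (ofRealForm_injective h')
  have hsurj : Surjective f := fun y ↦ by
    obtain ⟨η', hη', hy⟩ := (mem_integralHodgeClasses_one_iff_exists Φ).1
      ((mem_toIntSubmodule_addSubgroupOf_integralHodgeClasses_iff Φ).1 y.2)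
    exact ⟨⟨η', hη'⟩, Subtype.ext (Subtype.ext (by rw [hf]; exact hy))⟩
  exact ⟨LinearEquiv.ofBijective f ⟨hinj, hsurj⟩, fun D ↦ hf D⟩

set_option maxHeartbeats 800000 in
/-- **A basis of `S_X ⊂ H²(X, ℤ)` transported from a basis of `NS(X)`, and the indices `(1, ρ − 1)` of `s·B₂` on
it** (g43-#5's `(NS(X), B_N)` read inside the lattice `H²(X, ℤ)`): for every `ℤ`-basis `b` of `NS(X)` there is a
`ℤ`-basis `b_L` of `S_X` with `b_L(i) = b(i)_ℂ`, the Gram matrix `G = (B₂(b_L(i), b_L(i')))` has `det G ≠ 0`, and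
`(b⁺, b⁻)(s·G) = (1, ρ − 1)`. [cite: Hartshorne1977, Ch. V Rem. 1.9.1] [cite: ShiodaMitani1974, §1 ("`S̄_X` has the signature `(1, ρ − 1)`")] [cite: Lange2023AbelianVarietiesComplex, §5.1.2 (p. 244); §6.2.4 (PDF p. 310)] -/
theorem IsPolarizationType.exists_basis_integralHodgeClasses_sigPos_sigNeg_toBilin'_of_eq_poincarePairing_wedge
    (hd : IsPolarizationType Φ η d) (hη : IsRiemannForm Φ η) (hle : j ≤ j + 2) {γ : E [⋀^Fin (2 * j)]→L[ℝ] ℂ}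
    (hγ : wedgePow (ofRealForm η) j = ((j.factorial * ∏ i : Fin j, d (Fin.castLE hle i) : ℕ) : ℂ) • γ)
    (e : Fin n ≃ ι) (hn : 2 + (2 * j + 2) = n) {B : BilinForm ℤ ↥(integralForms Φ 2)}
    (hB : ∀ x y : ↥(integralForms Φ 2),
      ((B x y : ℤ) : ℂ) = poincarePairing Φ e hn (x : E [⋀^Fin 2]→L[ℝ] ℂ) (γ.wedge (y : E [⋀^Fin 2]→L[ℝ] ℂ)))
    {κ : Type*} [Fintype κ] [DecidableEq κ] (b : Basis κ ℤ (neronSeveriGroup Φ)) :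
    ∃ bL : Basis κ ℤ ↥(AddSubgroup.toIntSubmodule ((integralHodgeClasses Φ 1).addSubgroupOf (integralForms Φ 2))),
      (∀ i, (((bL i : ↥(AddSubgroup.toIntSubmodule ((integralHodgeClasses Φ 1).addSubgroupOf (integralForms Φ 2)))) : ↥(integralForms Φ 2)) : E [⋀^Fin 2]→L[ℝ] ℂ) =
        ofRealForm ((b i : neronSeveriGroup Φ) : E [⋀^Fin 2]→L[ℝ] ℝ)) ∧
      sigPos (Matrix.toBilin' ((orientationSign Φ e * (-1) ^ j) •
        LinearMap.BilinForm.toMatrix bL (B.restrict (AddSubgroup.toIntSubmodule ((integralHodgeClasses Φ 1).addSubgroupOf (integralForms Φ 2)))))).toQuadraticMap = 1 ∧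
      sigNeg (Matrix.toBilin' ((orientationSign Φ e * (-1) ^ j) •
        LinearMap.BilinForm.toMatrix bL (B.restrict (AddSubgroup.toIntSubmodule ((integralHodgeClasses Φ 1).addSubgroupOf (integralForms Φ 2)))))).toQuadraticMap = finrank ℤ (neronSeveriGroup Φ) - 1 ∧
      (LinearMap.BilinForm.toMatrix bL (B.restrict (AddSubgroup.toIntSubmodule ((integralHodgeClasses Φ 1).addSubgroupOf (integralForms Φ 2))))).det ≠ 0 := by
  have hex := exists_linearEquiv_neronSeveriGroup_integralHodgeClasses Φ
  obtain ⟨eNS, heNS⟩ := hex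
  refine ⟨b.map eNS, fun i ↦ by rw [Basis.map_apply, heNS], ?_⟩
  have hG : ∀ i i', ((LinearMap.BilinForm.toMatrix (b.map eNS) (B.restrict (AddSubgroup.toIntSubmodule ((integralHodgeClasses Φ 1).addSubgroupOf (integralForms Φ 2)))) i i' : ℤ) : ℂ) =
      poincarePairing Φ e hn (ofRealForm ((b i : neronSeveriGroup Φ) : E [⋀^Fin 2]→L[ℝ] ℝ))
        (γ.wedge (ofRealForm ((b i' : neronSeveriGroup Φ) : E [⋀^Fin 2]→L[ℝ] ℝ))) := fun i i' ↦ by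
    have hra : ∀ x y : ↥(AddSubgroup.toIntSubmodule ((integralHodgeClasses Φ 1).addSubgroupOf (integralForms Φ 2))), (B.restrict (AddSubgroup.toIntSubmodule ((integralHodgeClasses Φ 1).addSubgroupOf (integralForms Φ 2)))) x y = B (x : ↥(integralForms Φ 2)) (y : ↥(integralForms Φ 2)) :=
      fun _ _ ↦ rfl
    rw [LinearMap.BilinForm.toMatrix_apply, hra, Basis.map_apply, Basis.map_apply, hB, heNS, heNS]
  exact hd.sigPos_sigNeg_toBilin'_neronSeveriGroup_of_eq_poincarePairing_wedge hη hle hγ e hn b hG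

/-- **`(S_X, s·B₂) = (1, ρ − 1)`, `B₂|S_X` non-degenerate, `rk S_X = ρ`**: the Néron–Severi sublattice of `H²(X, ℤ)`
for the Lefschetz form of degree two is hyperbolic (Hartshorne V Rem. 1.9.1 on the lattice `S_X ≅ Num X`).
[cite: Hartshorne1977, Ch. V Rem. 1.9.1] [cite: ShiodaMitani1974, §1] [cite: Lange2023AbelianVarietiesComplex, §5.1.2 (p. 244); §6.2.4 (PDF p. 310)] [cite: Serre1973, Ch. V §1.3.2] -/
theorem IsPolarizationType.sigPos_sigNeg_smul_restrict_integralHodgeClasses_of_eq_poincarePairing_wedge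
    (hd : IsPolarizationType Φ η d) (hη : IsRiemannForm Φ η) (hle : j ≤ j + 2) {γ : E [⋀^Fin (2 * j)]→L[ℝ] ℂ}
    (hγ : wedgePow (ofRealForm η) j = ((j.factorial * ∏ i : Fin j, d (Fin.castLE hle i) : ℕ) : ℂ) • γ)
    (e : Fin n ≃ ι) (hn : 2 + (2 * j + 2) = n) {B : BilinForm ℤ ↥(integralForms Φ 2)}
    (hB : ∀ x y : ↥(integralForms Φ 2),
      ((B x y : ℤ) : ℂ) = poincarePairing Φ e hn (x : E [⋀^Fin 2]→L[ℝ] ℂ) (γ.wedge (y : E [⋀^Fin 2]→L[ℝ] ℂ))) :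
    sigPos (((orientationSign Φ e * (-1) ^ j) • B).restrict (AddSubgroup.toIntSubmodule ((integralHodgeClasses Φ 1).addSubgroupOf (integralForms Φ 2)))).toQuadraticMap = 1 ∧
      sigNeg (((orientationSign Φ e * (-1) ^ j) • B).restrict (AddSubgroup.toIntSubmodule ((integralHodgeClasses Φ 1).addSubgroupOf (integralForms Φ 2)))).toQuadraticMap = finrank ℤ (neronSeveriGroup Φ) - 1 ∧
      (B.restrict (AddSubgroup.toIntSubmodule ((integralHodgeClasses Φ 1).addSubgroupOf (integralForms Φ 2)))).Nondegenerate ∧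
      finrank ℤ ↥(AddSubgroup.toIntSubmodule ((integralHodgeClasses Φ 1).addSubgroupOf (integralForms Φ 2))) = finrank ℤ (neronSeveriGroup Φ) := by
  classical
  haveI := moduleFinite_neronSeveriGroup Φ
  haveI := moduleFree_neronSeveriGroup Φ
  let b := Module.Free.chooseBasis ℤ (neronSeveriGroup Φ)
  obtain ⟨bL, -, h1, h2, h3⟩ :=
    hd.exists_basis_integralHodgeClasses_sigPos_sigNeg_toBilin'_of_eq_poincarePairing_wedge hη hle hγ e hn hB b
  -- `(s • B)|S ≅ toBilin' (s • G)`
  have hres : ((orientationSign Φ e * (-1) ^ j) • B).restrict (AddSubgroup.toIntSubmodule ((integralHodgeClasses Φ 1).addSubgroupOf (integralForms Φ 2))) =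
      (orientationSign Φ e * (-1) ^ j) • B.restrict (AddSubgroup.toIntSubmodule ((integralHodgeClasses Φ 1).addSubgroupOf (integralForms Φ 2))) := rfl
  have heq := LinearMap.BilinForm.equivalent_toBilin'_toMatrix ((orientationSign Φ e * (-1) ^ j) • B.restrict (AddSubgroup.toIntSubmodule ((integralHodgeClasses Φ 1).addSubgroupOf (integralForms Φ 2)))) bL
  rw [map_smul] at heq
  have hq := sigPos_sigNeg_eq_of_equivalent₆₆ heq
  rw [hres, hq.1, hq.2]
  exact ⟨h1, h2, (LinearMap.BilinForm.nondegenerate_iff_det_ne_zero bL).2 h3,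
    (finrank_eq_card_basis bL).trans (finrank_eq_card_basis b).symm⟩

/-- **The transcendental lattice of a polarised abelian variety: `(NS(X)^⊥, s·B₂)` has
`(b⁺, b⁻) = (2·C(g,2), g² − ρ) = (2h^{2,0}, h^{1,1} − ρ)`** (`g = j + 2`, `s = sign·(−1)^j`, `NS(X)^⊥` the orthogonal
complement of `S_X = H²(X, ℤ) ∩ H^{1,1}` in `H²(X, ℤ)` for `B₂(x, y) = ⟨x, γ_{g−2} ∧ y⟩`): `b^±(H²) = b^±(S_X) + b^±(S_X^⊥)`
(§0) with `(2h^{2,0} + 1, h^{1,1} − 1)` on `H²(X, ℤ)` (g43-#3) and `(1, ρ − 1)` on `S_X`. The surface case `j = 0`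
(`B₂ = ` cup product) is Shioda–Mitani's `(2, 4 − ρ)`. [cite: ShiodaMitani1974, §1 ("`T_X` … signature `(2, 4 − ρ)`")] [cite: Huybrechts2016K3, Ch. 3 §3.3; Ch. 14 §0.2] [cite: Huybrechts2005, Cor. 3.3.16] [cite: Serre1973, Ch. V §1.3.2 and §1.3.7] -/
theorem IsPolarizationType.sigPos_sigNeg_smul_restrict_transcendental_of_eq_poincarePairing_wedge
    (hd : IsPolarizationType Φ η d) (hη : IsRiemannForm Φ η) (hle : j ≤ j + 2) {γ : E [⋀^Fin (2 * j)]→L[ℝ] ℂ}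
    (hγ : wedgePow (ofRealForm η) j = ((j.factorial * ∏ i : Fin j, d (Fin.castLE hle i) : ℕ) : ℂ) • γ)
    (e : Fin n ≃ ι) (hn : 2 + (2 * j + 2) = n) {B : BilinForm ℤ ↥(integralForms Φ 2)}
    (hB : ∀ x y : ↥(integralForms Φ 2),
      ((B x y : ℤ) : ℂ) = poincarePairing Φ e hn (x : E [⋀^Fin 2]→L[ℝ] ℂ) (γ.wedge (y : E [⋀^Fin 2]→L[ℝ] ℂ))) :
    sigPos (((orientationSign Φ e * (-1) ^ j) • B).restrict (B.orthogonal (AddSubgroup.toIntSubmodule ((integralHodgeClasses Φ 1).addSubgroupOf (integralForms Φ 2))))).toQuadraticMap = 2 * (j + 2).choose 2 ∧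
      sigNeg (((orientationSign Φ e * (-1) ^ j) • B).restrict (B.orthogonal (AddSubgroup.toIntSubmodule ((integralHodgeClasses Φ 1).addSubgroupOf (integralForms Φ 2))))).toQuadraticMap =
        (j + 2) * (j + 2) - finrank ℤ (neronSeveriGroup Φ) := by
  classical
  letI : LinearOrder ι := linearOrderOfOrientation e
  let bH : Basis {w : Fin 2 → ι // StrictMono w} ℤ ↥(integralForms Φ 2) := intLatMonomialBasis Φ 2
  haveI : Module.Finite ℤ ↥(integralForms Φ 2) := Module.Finite.of_basis bH
  haveI := moduleFinite_neronSeveriGroup Φ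
  haveI := moduleFree_neronSeveriGroup Φ
  have hs0 : orientationSign Φ e * (-1) ^ j ≠ 0 :=
    mul_ne_zero (by rcases orientationSign_eq_or Φ e with h | h <;> rw [h] <;> norm_num) (pow_ne_zero _ (by norm_num))
  have hBs := isSymm_of_eq_poincarePairing_wedge e hn hB
  obtain ⟨h1, h2, -, h4⟩ := hd.sigPos_sigNeg_smul_restrict_integralHodgeClasses_of_eq_poincarePairing_wedge hη hle hγ e hn hB
  obtain ⟨bL, -, -, -, hdet⟩ := hd.exists_basis_integralHodgeClasses_sigPos_sigNeg_toBilin'_of_eq_poincarePairing_wedge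
    hη hle hγ e hn hB (Module.Free.chooseBasis ℤ (neronSeveriGroup Φ))
  -- the Gram determinant of `s • B` on `S_X` is non-zero as well
  have hres : ((orientationSign Φ e * (-1) ^ j) • B).restrict (AddSubgroup.toIntSubmodule ((integralHodgeClasses Φ 1).addSubgroupOf (integralForms Φ 2))) =
      (orientationSign Φ e * (-1) ^ j) • B.restrict (AddSubgroup.toIntSubmodule ((integralHodgeClasses Φ 1).addSubgroupOf (integralForms Φ 2))) := rfl
  have hdet' : (LinearMap.BilinForm.toMatrix bL (((orientationSign Φ e * (-1) ^ j) • B).restrict (AddSubgroup.toIntSubmodule ((integralHodgeClasses Φ 1).addSubgroupOf (integralForms Φ 2))))).det ≠ 0 := by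
    rw [hres, map_smul, Matrix.det_smul]
    exact mul_ne_zero (pow_ne_zero _ hs0) hdet
  have hsum := sigPos_sigNeg_eq_add_restrict_orthogonal_of_det_ne_zero ((orientationSign Φ e * (-1) ^ j) • B)
    (LinearMap.BilinForm.isSymm_smul_of_isSymm _ _ hBs) _ bL hdet'
  rw [orthogonal_smul_eq_of_ne_zero B hs0] at hsum
  obtain ⟨hP, hM⟩ := hd.sigPos_sigNeg_smul_of_eq_poincarePairing_wedge hη hle hγ e hn hB
  rw [hP, h1] at hsum
  have hM' := hsum.2
  rw [hM, h2] at hM'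
  -- `ρ ≥ 1` (`b⁺(S_X) = 1 ≤ rk S_X = ρ`)
  have hρ1 : 1 ≤ finrank ℤ (neronSeveriGroup Φ) := by
    have h := LinearMap.BilinForm.sigPos_add_sigNeg_le_finrank
      (((orientationSign Φ e * (-1) ^ j) • B).restrict (AddSubgroup.toIntSubmodule ((integralHodgeClasses Φ 1).addSubgroupOf (integralForms Φ 2)))).toQuadraticMap
    rw [h1, h4] at h
    omega
  constructor
  · omega
  · omega

/-- **`rk NS(X)^⊥ = b₂ − ρ = C(2g, 2) − ρ`, `S_X ∩ S_X^⊥ = 0`, and `B₂|NS(X)^⊥` is non-degenerate** (`S_X ⊕ S_X^⊥` has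
finite index in `H²(X, ℤ)`). [cite: ShiodaMitani1974, §1] [cite: Huybrechts2016K3, Ch. 14 §0.1–§0.2] [cite: Kitaoka1993, Ch. 5 Prop. 5.3.3 (proof)] [cite: Lange2023AbelianVarietiesComplex, §1.1.3 Exercise 1.1.6 (8)] -/
theorem IsPolarizationType.finrank_nondegenerate_transcendental_of_eq_poincarePairing_wedge
    (hd : IsPolarizationType Φ η d) (hη : IsRiemannForm Φ η) (hle : j ≤ j + 2) {γ : E [⋀^Fin (2 * j)]→L[ℝ] ℂ}
    (hγ : wedgePow (ofRealForm η) j = ((j.factorial * ∏ i : Fin j, d (Fin.castLE hle i) : ℕ) : ℂ) • γ)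
    (e : Fin n ≃ ι) (hn : 2 + (2 * j + 2) = n) {B : BilinForm ℤ ↥(integralForms Φ 2)}
    (hB : ∀ x y : ↥(integralForms Φ 2),
      ((B x y : ℤ) : ℂ) = poincarePairing Φ e hn (x : E [⋀^Fin 2]→L[ℝ] ℂ) (γ.wedge (y : E [⋀^Fin 2]→L[ℝ] ℂ))) :
    finrank ℤ ↥(B.orthogonal (AddSubgroup.toIntSubmodule ((integralHodgeClasses Φ 1).addSubgroupOf (integralForms Φ 2)))) + finrank ℤ (neronSeveriGroup Φ) = (2 * (j + 2)).choose 2 ∧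
      (AddSubgroup.toIntSubmodule ((integralHodgeClasses Φ 1).addSubgroupOf (integralForms Φ 2))) ⊓ B.orthogonal (AddSubgroup.toIntSubmodule ((integralHodgeClasses Φ 1).addSubgroupOf (integralForms Φ 2))) = ⊥ ∧
      (B.restrict (B.orthogonal (AddSubgroup.toIntSubmodule ((integralHodgeClasses Φ 1).addSubgroupOf (integralForms Φ 2))))).Nondegenerate ∧
      0 < ((AddSubgroup.toIntSubmodule ((integralHodgeClasses Φ 1).addSubgroupOf (integralForms Φ 2))) ⊔ B.orthogonal (AddSubgroup.toIntSubmodule ((integralHodgeClasses Φ 1).addSubgroupOf (integralForms Φ 2)))).toAddSubgroup.index := by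
  classical
  letI : LinearOrder ι := linearOrderOfOrientation e
  let bH : Basis {w : Fin 2 → ι // StrictMono w} ℤ ↥(integralForms Φ 2) := intLatMonomialBasis Φ 2
  haveI : Module.Finite ℤ ↥(integralForms Φ 2) := Module.Finite.of_basis bH
  haveI : Module.Free ℤ ↥(integralForms Φ 2) := Module.Free.of_basis bH
  haveI := moduleFinite_neronSeveriGroup Φ
  haveI := moduleFree_neronSeveriGroup Φ
  have hBs := isSymm_of_eq_poincarePairing_wedge e hn hB
  have hBn := hd.nondegenerate_of_eq_poincarePairing_wedge hη hle hγ e hn hB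
  obtain ⟨-, -, hSn, h4⟩ := hd.sigPos_sigNeg_smul_restrict_integralHodgeClasses_of_eq_poincarePairing_wedge hη hle hγ e hn hB
  obtain ⟨bL, -, -, -, hdet⟩ := hd.exists_basis_integralHodgeClasses_sigPos_sigNeg_toBilin'_of_eq_poincarePairing_wedge
    hη hle hγ e hn hB (Module.Free.chooseBasis ℤ (neronSeveriGroup Φ))
  have hι : Fintype.card ι = 2 * (j + 2) := by
    rw [← Fintype.card_congr e, Fintype.card_fin]
    omega
  have hrk : finrank ℤ ↥(integralForms Φ 2) = (2 * (j + 2)).choose 2 := by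
    rw [← hι]
    exact finrank_integralForms_eq_choose Φ 2
  have hadd := LinearMap.BilinForm.finrank_add_finrank_orthogonal_of_nondegenerate B (AddSubgroup.toIntSubmodule ((integralHodgeClasses Φ 1).addSubgroupOf (integralForms Φ 2))) hBs hSn
  rw [h4, hrk] at hadd
  exact ⟨by omega, inf_orthogonal_eq_bot_of_det_ne_zero B _ bL hdet,
    nondegenerate_restrict_orthogonal_of_det_ne_zero B hBs hBn _ bL hdet,
    Literature.Topology.FourManifolds.index_sup_orthogonal_pos B _ hBs bL hdet⟩

/-- **Riemann form (type read off the torus)**: `(NS(X)^⊥, sign·(−1)^g·B₂) = (2·C(g,2), g² − ρ)` with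
`B₂(x, y) = ⟨x, γ_{g−2} ∧ y⟩`, `(g−2)!·d₁⋯d_{g−2}·γ_{g−2} = θ^{∧(g−2)}`, `d = hη.polarizationType` THE type of `(X, η)`.
[cite: ShiodaMitani1974, §1] [cite: Huybrechts2005, Cor. 3.3.16] [cite: Lange2023AbelianVarietiesComplex, §6.2.4 (PDF p. 310)] -/
theorem IsRiemannForm.sigPos_sigNeg_smul_restrict_transcendental_of_eq_poincarePairing_wedge (hη : IsRiemannForm Φ η)
    (hj : j + 2 = Fintype.card ι / 2) (hle : j ≤ j + 2) {γ : E [⋀^Fin (2 * j)]→L[ℝ] ℂ}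
    (hγ : wedgePow (ofRealForm η) j =
      ((j.factorial * ∏ i : Fin j, hη.polarizationType (Fin.cast hj (Fin.castLE hle i)) : ℕ) : ℂ) • γ)
    (e : Fin n ≃ ι) (hn : 2 + (2 * j + 2) = n) {B : BilinForm ℤ ↥(integralForms Φ 2)}
    (hB : ∀ x y : ↥(integralForms Φ 2),
      ((B x y : ℤ) : ℂ) = poincarePairing Φ e hn (x : E [⋀^Fin 2]→L[ℝ] ℂ) (γ.wedge (y : E [⋀^Fin 2]→L[ℝ] ℂ))) :
    sigPos (((orientationSign Φ e * (-1) ^ j) • B).restrict (B.orthogonal (AddSubgroup.toIntSubmodule ((integralHodgeClasses Φ 1).addSubgroupOf (integralForms Φ 2))))).toQuadraticMap = 2 * (j + 2).choose 2 ∧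
      sigNeg (((orientationSign Φ e * (-1) ^ j) • B).restrict (B.orthogonal (AddSubgroup.toIntSubmodule ((integralHodgeClasses Φ 1).addSubgroupOf (integralForms Φ 2))))).toQuadraticMap =
        (j + 2) * (j + 2) - finrank ℤ (neronSeveriGroup Φ) :=
  (hη.isPolarizationType_polarizationType.comp_cast hj).sigPos_sigNeg_smul_restrict_transcendental_of_eq_poincarePairing_wedge
    hη hle hγ e hn hB

/-- **Principally polarised abelian THREEFOLDS** (`B₂(x, y) = ⟨x, θ ∧ y⟩_e`, `s = −sign`): the transcendental lattice
`NS(X)^⊥ ⊂ H²(X, ℤ)` has `(b⁺, b⁻)(−sign·B₂) = (6, 9 − ρ)` and rank `15 − ρ`. [cite: ShiodaMitani1974, §1] [cite: Huybrechts2005, Cor. 3.3.16] [cite: Lange2023AbelianVarietiesComplex, §2.1.1; §6.2.4 (PDF p. 310)] -/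
theorem IsPrincipalPolarization.sigPos_sigNeg_smul_restrict_transcendental_threefold (hp : IsPrincipalPolarization Φ η)
    (e : Fin n ≃ ι) (hn : 2 + (2 * 1 + 2) = n) {B : BilinForm ℤ ↥(integralForms Φ 2)}
    (hB : ∀ x y : ↥(integralForms Φ 2), ((B x y : ℤ) : ℂ) =
      poincarePairing Φ e hn (x : E [⋀^Fin 2]→L[ℝ] ℂ) ((wedgePow (ofRealForm η) 1).wedge (y : E [⋀^Fin 2]→L[ℝ] ℂ))) :
    sigPos (((orientationSign Φ e * (-1) ^ 1) • B).restrict (B.orthogonal (AddSubgroup.toIntSubmodule ((integralHodgeClasses Φ 1).addSubgroupOf (integralForms Φ 2))))).toQuadraticMap = 6 ∧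
      sigNeg (((orientationSign Φ e * (-1) ^ 1) • B).restrict (B.orthogonal (AddSubgroup.toIntSubmodule ((integralHodgeClasses Φ 1).addSubgroupOf (integralForms Φ 2))))).toQuadraticMap =
        9 - finrank ℤ (neronSeveriGroup Φ) ∧
      finrank ℤ ↥(B.orthogonal (AddSubgroup.toIntSubmodule ((integralHodgeClasses Φ 1).addSubgroupOf (integralForms Φ 2)))) + finrank ℤ (neronSeveriGroup Φ) = 15 := by
  obtain ⟨g, d', hd', h1⟩ := hp.exists_type_eq_one
  have hg : 1 + 2 = g := by
    have h₁ := hd'.card_eq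
    have h₂ := Fintype.card_congr e
    rw [Fintype.card_fin] at h₂
    omega
  have hd := hd'.comp_cast hg
  have hle : 1 ≤ 1 + 2 := Nat.le_add_right 1 2
  have hγ : wedgePow (ofRealForm η) 1 =
      (((1 : ℕ).factorial * ∏ i : Fin 1, d' (Fin.cast hg (Fin.castLE hle i)) : ℕ) : ℂ) • wedgePow (ofRealForm η) 1 := by
    simp only [h1, Finset.prod_const_one, mul_one, Nat.factorial_one, Nat.cast_one, one_smul]
  have hA := hd.sigPos_sigNeg_smul_restrict_transcendental_of_eq_poincarePairing_wedge hp.isRiemannForm hle hγ e hn hB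
  have hC := (hd.finrank_nondegenerate_transcendental_of_eq_poincarePairing_wedge hp.isRiemannForm hle hγ e hn hB).1
  have h6 : 2 * (1 + 2).choose 2 = 6 := by decide
  have h15 : (2 * (1 + 2)).choose 2 = 15 := by decide
  rw [h6] at hA
  rw [h15] at hC
  exact ⟨hA.1, hA.2, hC⟩

end Transcendental

end Literature.Geometry.Kaehler.ComplexTorus
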